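import Summits.BirchSwinnertonDyer.BirchSwinnertonDyer.Theorems.Rank2ObservatoryReductionWitness2
import Summits.BirchSwinnertonDyer.BirchSwinnertonDyer.Theorems.Rank2ObservatoryCosetWitness3
import Literature.NumberTheory.EllipticCurves.BSDInvariantsProofs
import HarnessLib

/-!
# BirchSwinnertonDyer — rank ≥ 2 observatory: the kernel rank certificate for THREE points

HONEST FRAMING: per-curve certified theorems and census instruments; no claim on BSD in rank ≥ 2.

The rank-3 arm of the census (`Rank2ObservatoryRank3Table.lean`, `Rank2ObservatoryRank3Census.lean`)
carries the certificate field `rank_lower` as the named hypothesis `hlow : 3 ≤ rank_ℤ E(ℚ)`. This file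
assembles, from the machinery of the rank-2 kernel certificates (`reduceMod`, `annihilatorCheck`,
`xDoubleFree`, `xCosetFree`) and the three-point coset criterion
(`Rank2ObservatoryCosetWitness3.lean`), ONE theorem that discharges it from decidable data:

* `zmodChord V q x₁ y₁ x₂ y₂ x₃ y₃` — the CHORD CERTIFICATE MODULO `q` (Boolean: `x₁ ≠ x₂` and the
  denominator-cleared chord formulas, Silverman AEC III.2.3) with soundness
  `exists_some_add_some_of_zmodChord`: in `Ẽ(𝔽_q)`, `(x₁,y₁) + (x₂,y₂) = (x₃,y₃)`. Sums are taken
  AFTER reduction, so `P₁ + P₂`, … need not be integral points of `E(ℚ)`;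
* `cosetFreeB V q u α β` — the witness Boolean for annihilator exponent `u`: the doubling test
  (`u = 0`: `(α,β) ∉ 2Ẽ(𝔽_q)`) or the coset test (`u = 1`: `(α,β) ∉ 2Ẽ(𝔽_q) + Ẽ(𝔽_q)[2]`), with
  soundness `not_mem_twoCoset_of_cosetFreeB`; `u ≥ 2` is `false` (out of scope);
* **`three_le_mordellWeilRank_of_kernelCert`** — three integral points on `V`, a torsion annihilator
  `t = 2^u · m` (`m` odd) certified by `annihilatorCheck` over kernel-counted good primes, and for
  each of the seven combinations `ε₁P₁ + ε₂P₂ + ε₃P₃` a good prime `q_ε` with the reduced combination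
  (chords mod `q_ε`) outside `2Ẽ + Ẽ[2^u]` give `3 ≤ rank_ℤ E(ℚ)` (`E = V.map (ℤ → ℚ)`), via
  `three_le_mordellWeilRank_of_cosetWitness` and the Mordell–Weil theorem proved in the tree. Every
  hypothesis is a decidable statement about integers / residues, discharged per curve by `decide`
  (kernel; no `native_decide`);
* `scaleModel V d = [d a₁, d² a₂, d³ a₃, d⁴ a₄, d⁶ a₆]` and `mordellWeilRank_scaleModel` — the rank
  of the scaled model equals that of `V` (`(x,y) ↦ (d²x, d³y)` is the admissible change of variables
  `u = d⁻¹`; the tree's `mordellWeilRank_variableChange_holds`), so rows whose listed generators are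
  not integral are certified on a scaled model with integral points.

Scope (stated, not hidden): annihilator exponent `u ≤ 1` (no full rational `2`-torsion, no rational
`4`-torsion); the `27` rank-3 census rows with `u = 2` are listed as out of scope in the cell index.
Sorry-free; axioms `propext`, `Classical.choice`, `Quot.sound` only.
References: Silverman AEC (2009) III.2.3, III.3.1(b), Prop. VII.3.1(b), Thm. VIII.6.7; Cremona (1997)
§3.5; Siksek, Rocky Mountain J. Math. 25 (1995).
-/

-- single-conjunct summit: `Summit.BirchSwinnertonDyer.BirchSwinnertonDyer.…` repeats the name by design
set_option linter.dupNamespace false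

namespace Summit.BirchSwinnertonDyer.BirchSwinnertonDyer.Rank2Observatory

open WeierstrassCurve Literature.NumberTheory.EllipticCurves

/-! ### The chord certificate modulo `q` -/

section Chord

/-- CHORD CERTIFICATE modulo `q`, denominators cleared (a Boolean for `decide`):
`(x₃, y₃) = (x₁, y₁) + (x₂, y₂)` on `V mod q` with `x₁ ≠ x₂`, `d = x₁ − x₂`, `m = y₁ − y₂`:
`x₃·d² = m² + a₁·m·d − (a₂ + x₁ + x₂)·d²` and `y₃·d = −(m·(x₃ − x₁) + y₁·d) − a₁·x₃·d − a₃·d`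
(Silverman AEC III.2.3; as `intChord`, but over `ZMod q`). [cite: SilvermanAEC2009, III.2.3] -/
def zmodChord (V : WeierstrassCurve ℤ) (q : ℕ) [NeZero q] (x₁ y₁ x₂ y₂ x₃ y₃ : ZMod q) : Bool :=
  decide (x₁ ≠ x₂ ∧
    x₃ * (x₁ - x₂) ^ 2 =
      (y₁ - y₂) ^ 2 + (V.a₁ : ZMod q) * (y₁ - y₂) * (x₁ - x₂)
        - ((V.a₂ : ZMod q) + x₁ + x₂) * (x₁ - x₂) ^ 2 ∧
    y₃ * (x₁ - x₂) =
      -((y₁ - y₂) * (x₃ - x₁) + y₁ * (x₁ - x₂)) - (V.a₁ : ZMod q) * x₃ * (x₁ - x₂)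
        - (V.a₃ : ZMod q) * (x₁ - x₂))

variable (V : WeierstrassCurve ℤ) (q : ℕ) [Fact q.Prime]

/-- Transport of `Point.some` along equal coordinates. [folklore] -/
private theorem some_congr₃ {F : Type*} [CommRing F] {W : Affine F} {x y x' y' : F}
    (hx : x = x') (hy : y = y') (h : W.Nonsingular x y) :
    ∃ h' : W.Nonsingular x' y', Affine.Point.some x y h = .some x' y' h' := by
  subst hx hy
  exact ⟨h, rfl⟩

/-- **Soundness of the chord certificate modulo `q`**: in `Ẽ(𝔽_q)` the two affine points add to the
certified point (Mathlib's `add_of_X_ne`, `slope_of_X_ne`, clearing `x₁ − x₂ ≠ 0`).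
[cite: SilvermanAEC2009, III.2.3] -/
theorem exists_some_add_some_of_zmodChord {x₁ y₁ x₂ y₂ x₃ y₃ : ZMod q}
    (h₁ : (V.map (Int.castRingHom (ZMod q))).toAffine.Nonsingular x₁ y₁)
    (h₂ : (V.map (Int.castRingHom (ZMod q))).toAffine.Nonsingular x₂ y₂)
    (hc : zmodChord V q x₁ y₁ x₂ y₂ x₃ y₃ = true) :
    ∃ h₃ : (V.map (Int.castRingHom (ZMod q))).toAffine.Nonsingular x₃ y₃,
      (Affine.Point.some x₁ y₁ h₁ : (V.map (Int.castRingHom (ZMod q))).toAffine.Point) +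
        .some x₂ y₂ h₂ = .some x₃ y₃ h₃ := by
  classical
  simp only [zmodChord, decide_eq_true_eq] at hc
  obtain ⟨hne, hX, hY⟩ := hc
  have hd : x₁ - x₂ ≠ 0 := sub_ne_zero.mpr hne
  have ha₁ : (V.map (Int.castRingHom (ZMod q))).a₁ = (V.a₁ : ZMod q) := by
    simp [WeierstrassCurve.map]
  have ha₂ : (V.map (Int.castRingHom (ZMod q))).a₂ = (V.a₂ : ZMod q) := by
    simp [WeierstrassCurve.map]
  have ha₃ : (V.map (Int.castRingHom (ZMod q))).a₃ = (V.a₃ : ZMod q) := by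
    simp [WeierstrassCurve.map]
  rw [Affine.Point.add_of_X_ne hne]
  set L := (V.map (Int.castRingHom (ZMod q))).toAffine.slope x₁ x₂ y₁ y₂ with hLdef
  have hLd : L * (x₁ - x₂) = y₁ - y₂ := by
    rw [hLdef, Affine.slope_of_X_ne hne]; exact div_mul_cancel₀ _ hd
  have hX3 : (V.map (Int.castRingHom (ZMod q))).toAffine.addX x₁ x₂ L = x₃ := by
    apply mul_right_cancel₀ (pow_ne_zero 2 hd)
    rw [hX, ← hLd]
    simp only [Affine.addX, ha₁, ha₂]
    ring
  have hY3 : (V.map (Int.castRingHom (ZMod q))).toAffine.addY x₁ x₂ y₁ L = y₃ := by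
    apply mul_right_cancel₀ hd
    rw [hY, ← hLd]
    simp only [Affine.addY, Affine.negAddY, Affine.negY, hX3, ha₁, ha₃]
    ring
  exact some_congr₃ hX3 hY3 _

end Chord

/-! ### The witness Boolean for annihilator exponent `u ∈ {0, 1}` -/

section Witness

/-- The coset witness for exponent `u` (a Boolean for `decide`): `u = 0` — the doubling test
`xDoubleFree` (`(α, β) ∉ 2Ẽ(𝔽_q)`); `u = 1` — the coset test `xCosetFree`
(`(α, β) ∉ 2Ẽ(𝔽_q) + Ẽ(𝔽_q)[2]`); `u ≥ 2` — `false` (not treated). [cite: SilvermanAEC2009, III.2.3] -/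
def cosetFreeB (V : WeierstrassCurve ℤ) (q : ℕ) [NeZero q] : ℕ → ZMod q → ZMod q → Bool
  | 0, α, _ => xDoubleFree V q α
  | 1, α, β => xCosetFree V q α β
  | _ + 2, _, _ => false

variable (V : WeierstrassCurve ℤ) (q : ℕ) [Fact q.Prime]

/-- **Soundness of the witness Boolean**: `cosetFreeB V q u α β = true` puts the affine point
`(α, β)` of `Ẽ(𝔽_q)` outside `twoCoset _ u = 2Ẽ(𝔽_q) + Ẽ(𝔽_q)[2^u]`
(`not_mem_twoCoset_of_xDoubleFree`, `not_mem_twoCoset_one_of_xCosetFree`).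
[cite: SilvermanAEC2009, III.2.3] -/
theorem not_mem_twoCoset_of_cosetFreeB {u : ℕ} {α β : ZMod q}
    (hfree : cosetFreeB V q u α β = true)
    (h : (V.map (Int.castRingHom (ZMod q))).toAffine.Nonsingular α β) :
    (Affine.Point.some α β h : (V.map (Int.castRingHom (ZMod q))).toAffine.Point) ∉
      twoCoset (V.map (Int.castRingHom (ZMod q))).toAffine.Point u := by
  match u, hfree with
  | 0, hfree => exact not_mem_twoCoset_of_xDoubleFree V q hfree h
  | 1, hfree => exact not_mem_twoCoset_one_of_xCosetFree V q hfree h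
  | _ + 2, hfree => exact absurd hfree (by simp [cosetFreeB])

end Witness

/-! ### Scaled models -/

section Scale

/-- The SCALED MODEL `[d a₁, d² a₂, d³ a₃, d⁴ a₄, d⁶ a₆]` of an integral model: the image of `V`
under the admissible change of variables `(x, y) ↦ (d²x, d³y)` (`u = d⁻¹`, `r = s = t = 0`,
Silverman AEC III.1), used to make listed rational generators integral. [cite: SilvermanAEC2009, III.3.1(b)] -/
def scaleModel (V : WeierstrassCurve ℤ) (d : ℤ) : WeierstrassCurve ℤ :=
  ⟨d * V.a₁, d ^ 2 * V.a₂, d ^ 3 * V.a₃, d ^ 4 * V.a₄, d ^ 6 * V.a₆⟩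

variable (V : WeierstrassCurve ℤ)

/-- The scaled model over `ℚ` is the variable change `⟨(d)⁻¹, 0, 0, 0⟩ • (V over ℚ)`. [cite: SilvermanAEC2009, III.3.1(b)] -/
theorem map_scaleModel_eq_smul {d : ℤ} (hd : d ≠ 0) :
    (scaleModel V d).map (Int.castRingHom ℚ) =
      (⟨(Units.mk0 (d : ℚ) (by exact_mod_cast hd))⁻¹, 0, 0, 0⟩ : VariableChange ℚ) •
        V.map (Int.castRingHom ℚ) := by
  ext <;> simp [scaleModel, WeierstrassCurve.map, variableChange_def]

/-- **The rank of the scaled model is the rank of `V`** (the tree's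
`mordellWeilRank_variableChange_holds`, Silverman AEC III.3.1(b) with VIII.6).
[cite: SilvermanAEC2009, III.3.1(b)] -/
theorem mordellWeilRank_scaleModel {d : ℤ} (hd : d ≠ 0) :
    ((scaleModel V d).map (Int.castRingHom ℚ)).mordellWeilRank =
      (V.map (Int.castRingHom ℚ)).mordellWeilRank := by
  rw [map_scaleModel_eq_smul V hd]
  exact mordellWeilRank_variableChange_holds _ _

end Scale

/-! ### The assembly: the kernel certificate gives `rank_ℤ E(ℚ) ≥ 3` -/

section Assembly

variable (V : WeierstrassCurve ℤ)

/-- **The kernel certificate gives `rank_ℤ E(ℚ) ≥ 3`.** Inputs, every one a decidable statement about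
the integers and residues of the row (discharged per curve by `decide`): three integral points
`Pᵢ = (Xᵢ, Yᵢ)` on `V`; a torsion annihilator `t = 2^u · m`, `m` odd, with `annihilatorCheck S t`
for a list `S` of kernel-counted good primes (`hS`, by `killers_cons` / `killers_nil`); for each of
the seven combinations `P₁`, `P₂`, `P₃`, `P₁+P₂`, `P₁+P₃`, `P₂+P₃`, `P₁+P₂+P₃` a good prime at which
the reduced combination — computed by chord certificates MODULO that prime (`zmodChord`; residues
`X₁₂, Y₁₂, …` supplied) — passes the witness `cosetFreeB … u` (outside `2Ẽ + Ẽ[2^u]`). Output: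
`3 ≤ rank_ℤ E(ℚ)` for `E = V.map (ℤ → ℚ)`, by `three_le_mordellWeilRank_of_cosetWitness` with the
witnesses pulled back along the reduction homomorphisms `reduceMod V q` and the Mordell–Weil theorem
proved in the tree. [cite: SilvermanAEC2009, Prop. VII.3.1(b) and Thm. VIII.6.7]
[cite: CremonaAlgorithms1997, §3.5] -/
theorem three_le_mordellWeilRank_of_kernelCert {X₁ Y₁ X₂ Y₂ X₃ Y₃ : ℤ}
    (h₁ : Y₁ ^ 2 + V.a₁ * X₁ * Y₁ + V.a₃ * Y₁ = X₁ ^ 3 + V.a₂ * X₁ ^ 2 + V.a₄ * X₁ + V.a₆)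
    (h₂ : Y₂ ^ 2 + V.a₁ * X₂ * Y₂ + V.a₃ * Y₂ = X₂ ^ 3 + V.a₂ * X₂ ^ 2 + V.a₄ * X₂ + V.a₆)
    (h₃ : Y₃ ^ 2 + V.a₁ * X₃ * Y₃ + V.a₃ * Y₃ = X₃ ^ 3 + V.a₂ * X₃ ^ 2 + V.a₄ * X₃ + V.a₆)
    {S : List (ℕ × ℕ)} {t u m : ℕ} (hm : m % 2 = 1) (htm : t = 2 ^ u * m)
    (hS : ∀ ℓN ∈ S, ℓN.1.Prime ∧
      ∀ (x : (V.map (Int.castRingHom ℚ)).toAffine.Point) (n : ℕ), ¬ ℓN.1 ∣ n → n • x = 0 →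
        ℓN.2 • x = 0)
    (ht : annihilatorCheck S t = true)
    (q₁ q₂ q₃ q₁₂ q₁₃ q₂₃ q₁₂₃ : ℕ) [Fact q₁.Prime] [Fact q₂.Prime] [Fact q₃.Prime]
    [Fact q₁₂.Prime] [Fact q₁₃.Prime] [Fact q₂₃.Prime] [Fact q₁₂₃.Prime]
    (hq₁ : ¬ (q₁ : ℤ) ∣ V.Δ) (hq₂ : ¬ (q₂ : ℤ) ∣ V.Δ) (hq₃ : ¬ (q₃ : ℤ) ∣ V.Δ)
    (hq₁₂ : ¬ (q₁₂ : ℤ) ∣ V.Δ) (hq₁₃ : ¬ (q₁₃ : ℤ) ∣ V.Δ) (hq₂₃ : ¬ (q₂₃ : ℤ) ∣ V.Δ)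
    (hq₁₂₃ : ¬ (q₁₂₃ : ℤ) ∣ V.Δ)
    (hw₁ : cosetFreeB V q₁ u (X₁ : ZMod q₁) (Y₁ : ZMod q₁) = true)
    (hw₂ : cosetFreeB V q₂ u (X₂ : ZMod q₂) (Y₂ : ZMod q₂) = true)
    (hw₃ : cosetFreeB V q₃ u (X₃ : ZMod q₃) (Y₃ : ZMod q₃) = true)
    {X₁₂ Y₁₂ : ℤ}
    (hc₁₂ : zmodChord V q₁₂ (X₁ : ZMod q₁₂) (Y₁ : ZMod q₁₂) (X₂ : ZMod q₁₂) (Y₂ : ZMod q₁₂)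
      (X₁₂ : ZMod q₁₂) (Y₁₂ : ZMod q₁₂) = true)
    (hw₁₂ : cosetFreeB V q₁₂ u (X₁₂ : ZMod q₁₂) (Y₁₂ : ZMod q₁₂) = true)
    {X₁₃ Y₁₃ : ℤ}
    (hc₁₃ : zmodChord V q₁₃ (X₁ : ZMod q₁₃) (Y₁ : ZMod q₁₃) (X₃ : ZMod q₁₃) (Y₃ : ZMod q₁₃)
      (X₁₃ : ZMod q₁₃) (Y₁₃ : ZMod q₁₃) = true)
    (hw₁₃ : cosetFreeB V q₁₃ u (X₁₃ : ZMod q₁₃) (Y₁₃ : ZMod q₁₃) = true)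
    {X₂₃ Y₂₃ : ℤ}
    (hc₂₃ : zmodChord V q₂₃ (X₂ : ZMod q₂₃) (Y₂ : ZMod q₂₃) (X₃ : ZMod q₂₃) (Y₃ : ZMod q₂₃)
      (X₂₃ : ZMod q₂₃) (Y₂₃ : ZMod q₂₃) = true)
    (hw₂₃ : cosetFreeB V q₂₃ u (X₂₃ : ZMod q₂₃) (Y₂₃ : ZMod q₂₃) = true)
    {X₀ Y₀ X₁₂₃ Y₁₂₃ : ℤ}
    (hc₀ : zmodChord V q₁₂₃ (X₁ : ZMod q₁₂₃) (Y₁ : ZMod q₁₂₃) (X₂ : ZMod q₁₂₃) (Y₂ : ZMod q₁₂₃)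
      (X₀ : ZMod q₁₂₃) (Y₀ : ZMod q₁₂₃) = true)
    (hc₁₂₃ : zmodChord V q₁₂₃ (X₀ : ZMod q₁₂₃) (Y₀ : ZMod q₁₂₃) (X₃ : ZMod q₁₂₃) (Y₃ : ZMod q₁₂₃)
      (X₁₂₃ : ZMod q₁₂₃) (Y₁₂₃ : ZMod q₁₂₃) = true)
    (hw₁₂₃ : cosetFreeB V q₁₂₃ u (X₁₂₃ : ZMod q₁₂₃) (Y₁₂₃ : ZMod q₁₂₃) = true) :
    3 ≤ (V.map (Int.castRingHom ℚ)).mordellWeilRank := by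
  classical
  have hΔ : V.Δ ≠ 0 := Δ_ne_zero_of_not_dvd V hq₁
  haveI := isElliptic_rat V hΔ
  have hm' : Odd (m : ℤ) := by exact_mod_cast Nat.odd_iff.mpr hm
  have htm' : (t : ℤ) = 2 ^ u * (m : ℤ) := by rw [htm]; push_cast; ring
  have htors : ∀ x : (V.map (Int.castRingHom ℚ)).toAffine.Point, IsOfFinAddOrder x →
      ((2 : ℤ) ^ u * (m : ℤ)) • x = 0 :=
    fun x hx => zsmul_eq_zero_of_annihilatorCheck hS ht htm' x hx
  have e₁ : V.toAffine.Equation X₁ Y₁ := (Affine.equation_iff X₁ Y₁).mpr h₁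
  have e₂ : V.toAffine.Equation X₂ Y₂ := (Affine.equation_iff X₂ Y₂).mpr h₂
  have e₃ : V.toAffine.Equation X₃ Y₃ := (Affine.equation_iff X₃ Y₃).mpr h₃
  refine three_le_mordellWeilRank_of_cosetWitness (V.map (Int.castRingHom ℚ)) hm' htors
    (P₁ := .some _ _ (nonsingular_rat_of_eq V hΔ h₁))
    (P₂ := .some _ _ (nonsingular_rat_of_eq V hΔ h₂))
    (P₃ := .some _ _ (nonsingular_rat_of_eq V hΔ h₃)) ?_ ?_ ?_ ?_ ?_ ?_ ?_
  · refine not_mem_twoCoset_of_map_not_mem (reduceMod V q₁ hq₁) ?_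
    rw [reduceMod_some V q₁ hq₁ e₁]
    exact not_mem_twoCoset_of_cosetFreeB V q₁ hw₁ _
  · refine not_mem_twoCoset_of_map_not_mem (reduceMod V q₂ hq₂) ?_
    rw [reduceMod_some V q₂ hq₂ e₂]
    exact not_mem_twoCoset_of_cosetFreeB V q₂ hw₂ _
  · refine not_mem_twoCoset_of_map_not_mem (reduceMod V q₃ hq₃) ?_
    rw [reduceMod_some V q₃ hq₃ e₃]
    exact not_mem_twoCoset_of_cosetFreeB V q₃ hw₃ _
  · refine not_mem_twoCoset_of_map_not_mem (reduceMod V q₁₂ hq₁₂) ?_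
    rw [map_add, reduceMod_some V q₁₂ hq₁₂ e₁, reduceMod_some V q₁₂ hq₁₂ e₂]
    obtain ⟨h', e⟩ := exists_some_add_some_of_zmodChord V q₁₂ _ _ hc₁₂
    rw [e]
    exact not_mem_twoCoset_of_cosetFreeB V q₁₂ hw₁₂ _
  · refine not_mem_twoCoset_of_map_not_mem (reduceMod V q₁₃ hq₁₃) ?_
    rw [map_add, reduceMod_some V q₁₃ hq₁₃ e₁, reduceMod_some V q₁₃ hq₁₃ e₃]
    obtain ⟨h', e⟩ := exists_some_add_some_of_zmodChord V q₁₃ _ _ hc₁₃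
    rw [e]
    exact not_mem_twoCoset_of_cosetFreeB V q₁₃ hw₁₃ _
  · refine not_mem_twoCoset_of_map_not_mem (reduceMod V q₂₃ hq₂₃) ?_
    rw [map_add, reduceMod_some V q₂₃ hq₂₃ e₂, reduceMod_some V q₂₃ hq₂₃ e₃]
    obtain ⟨h', e⟩ := exists_some_add_some_of_zmodChord V q₂₃ _ _ hc₂₃
    rw [e]
    exact not_mem_twoCoset_of_cosetFreeB V q₂₃ hw₂₃ _
  · refine not_mem_twoCoset_of_map_not_mem (reduceMod V q₁₂₃ hq₁₂₃) ?_
    rw [map_add, map_add, reduceMod_some V q₁₂₃ hq₁₂₃ e₁, reduceMod_some V q₁₂₃ hq₁₂₃ e₂,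
      reduceMod_some V q₁₂₃ hq₁₂₃ e₃]
    obtain ⟨h', e⟩ := exists_some_add_some_of_zmodChord V q₁₂₃ _ _ hc₀
    rw [e]
    obtain ⟨h'', e'⟩ := exists_some_add_some_of_zmodChord V q₁₂₃ _ _ hc₁₂₃
    rw [e']
    exact not_mem_twoCoset_of_cosetFreeB V q₁₂₃ hw₁₂₃ _

end Assembly

end Summit.BirchSwinnertonDyer.BirchSwinnertonDyer.Rank2Observatory
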